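import Summits.BirchSwinnertonDyer.BirchSwinnertonDyer.Theorems.ResidualThetaTransportAtTwoThetaLayerLambdaCongruenceAtTwoCuspSpanPrimePowTools
import Mathlib.NumberTheory.LSeries.PrimesInAP
import Mathlib.NumberTheory.LegendreSymbol.QuadraticReciprocity
import Mathlib.Tactic.NormNum.LegendreSymbol
import Mathlib.Data.Nat.Factorization.Basic
import HarnessLib

/-!
# Route `ResidualThetaTransportAtTwo`, node 27436 (cruxes Kan⁺ stmt-BirchSwinnertonDyer-20688 / Kμ⁺ 20689 / 21437), composite levels:
# TOOLS for killing the rows `B_m` — row values, the companion, the `β₃` step, and the auxiliary prime for `B₃`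

Cell `bsd-wall`, width seat `bsd-wall-rtt-p3-w2` g4 (2026-08-28). THEOREMS ONLY; `--supports stmt-BirchSwinnertonDyer-20688`; BSD is not
proved by this. Context: at composite `N` the node is equivalent to the generation statement (G‴)_N «χ additive, killing small trace, the
`4^k`-classes and `B₁ = {b = −1}` ⟹ χ = 0» (w4 g2, `cuspSpanEvenAtTwo_of_forall_b1_odd`); at levels with three prime factors `B₁` does not
span and further ROWS `B_m = {b = −m}` are needed (rtt-p4-w2 g6 §3g); `B₂`, `B_{4^i}` are free (w4). Here: `B₃` is free whenever `3 ∤ N`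
— by a `3`-ADIC TRIANGLE with the auxiliary prime chosen by Dirichlet + reciprocity, no Artin-type input.

CONSTRUCTION (`chi_eq_zero_of_apply_zero_one_eq_neg_three`). `γ = (a, −3; c, d)`; replacing `γ` by the companion `(−d, −3; c, −a)` (`γ·γ' = −I`)
if necessary, `d ≡ 2 (mod 3)`. `χ γ` depends only on `(a, d) mod 3N` (§1). Let `w := v₂(φ(N))`; Dirichlet gives a prime
`n ≡ 2d⁻¹ (mod N)`, `n ≡ 2 (mod 3)`, `n ≡ 1 + 2^{w+2} (mod 2^{w+3})`; reciprocity `(3/n) = (n/3) = (2/3) = −1` gives `3^h ≡ −1 (mod n)`,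
`h = (n−1)/2`, `2^w ∣ h`; with `T := h · (odd part of φ(N))`: `3^T ≡ −1 (mod n)`, `3^T ≡ 1 (mod N)` (Euler). Then `d* := (3^T + 1)/n ≡ d
(mod 3N)`, so `γ* := (a, −3; c*, d*)` has `χ γ* = χ γ`; the `B₁`-element `β'` with `d' := (3^{T−1} + c*)/d*` gives `(γ*β')₁₁ = 3^{T−1}` and
`(γ*β')₀₁ · d* = −1 − 3·3^{T−1}`, whence `(γ*β')₁₀ ≡ d* ≡ 2 (mod 3)`; HENSEL (`exists_hensel_four` at `q = 3`, `e = 1`) gives `k ≥ 1` with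
`3^{T−1} ∣ (γ*β')₁₀ + 4^k`, and a `B₁`-element `β₃` with `(γ*β'β₃)₁₁ = 4^k` exactly. So `χ γ = χ β' + χ β₃ + 0 = 0`.

* §1 `chi_eq_of_row` — `χ β = χ β'` when `b(β) = b(β') = b` and `a ≡ a', d ≡ d' (mod N|b|)`; the companion `(−d, b; c, −a)`.
* §2 `exists_b1_mul_apply_one_one_eq_four_pow` — the `β₃` step at any odd level.
* §3 the auxiliary prime (`exists_aux_prime_three`).
* §4 **`chi_eq_zero_of_apply_zero_one_eq_neg_three`**, `chi_eq_zero_of_natAbs_apply_zero_one_eq_three`.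

References: P. G. L. Dirichlet (1837) / Mathlib `PrimesInAP`; [Rademacher1929] §1; [Knapp1993] Prop. 11.1; [Pollack2003] Conj. 6.3.
-/

set_option autoImplicit false
set_option linter.dupNamespace false

open scoped MatrixGroups

open CongruenceSubgroup

namespace Summit.BirchSwinnertonDyer.BirchSwinnertonDyer.Theorems.SignedMuAtTwo

/-! ## §1. Row values and the companion -/

section AnyLevel

variable {N : ℕ} {χ : Gamma0 N → ZMod 2}

/-- **Row values depend only on `(a, d) mod N|b|`.** For additive `χ` killing the small-trace elements and `β, β' ∈ Γ₀(N)` with the same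
upper-right entry `b` and `N b ∣ a − a'`, `N b ∣ d − d'`: `χ β = χ β'` (`β' = L_t β L_s`). [folklore] -/
theorem chi_eq_of_row
    (hadd : ∀ γ δ : Gamma0 N, χ (γ * δ) = χ γ + χ δ)
    (hsmall : ∀ γ : Gamma0 N, ((γ : SL(2, ℤ)) 0 0 + (γ : SL(2, ℤ)) 1 1).natAbs ≤ 2 → χ γ = 0)
    {β β' : Gamma0 N} {b : ℤ} (hb0 : b ≠ 0) (hb : (β : SL(2, ℤ)) 0 1 = b) (hb' : (β' : SL(2, ℤ)) 0 1 = b)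
    (ha : (N : ℤ) * b ∣ (β' : SL(2, ℤ)) 0 0 - (β : SL(2, ℤ)) 0 0)
    (hd : (N : ℤ) * b ∣ (β' : SL(2, ℤ)) 1 1 - (β : SL(2, ℤ)) 1 1) : χ β = χ β' := by
  obtain ⟨s, hs⟩ := ha
  obtain ⟨t, ht⟩ := hd
  obtain ⟨L, hL00, hL01, hL10, hL11⟩ :=
    ThetaLayerLambdaCongruenceAtTwo.exists_gamma0_entries (N := N) 1 0 ((N : ℤ) * t) 1 (by ring) (dvd_mul_right _ _)
  obtain ⟨L', hL'00, hL'01, hL'10, hL'11⟩ :=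
    ThetaLayerLambdaCongruenceAtTwo.exists_gamma0_entries (N := N) 1 0 ((N : ℤ) * s) 1 (by ring) (dvd_mul_right _ _)
  have hL : χ L = 0 := hsmall L (by rw [hL00, hL11]; rfl)
  have hL' : χ L' = 0 := hsmall L' (by rw [hL'00, hL'11]; rfl)
  have hdet := Matrix.SpecialLinearGroup.det_coe (β : SL(2, ℤ))
  have hdet' := Matrix.SpecialLinearGroup.det_coe (β' : SL(2, ℤ))
  rw [Matrix.det_fin_two, hb] at hdet
  rw [Matrix.det_fin_two, hb'] at hdet'
  -- entries of `L β L'`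
  have e00 : ((L * β : Gamma0 N) : SL(2, ℤ)) 0 0 = (β : SL(2, ℤ)) 0 0 := by
    rw [gamma0_mul_apply_zero_zero', hL00, hL01]; ring
  have e01 : ((L * β : Gamma0 N) : SL(2, ℤ)) 0 1 = b := by
    rw [gamma0_mul_apply_zero_one, hL00, hL01, hb]; ring
  have e11 : ((L * β : Gamma0 N) : SL(2, ℤ)) 1 1 = (β : SL(2, ℤ)) 1 1 + N * t * b := by
    rw [gamma0_mul_apply_one_one', hL10, hL11, hb]; ring
  have f00 : ((L * β * L' : Gamma0 N) : SL(2, ℤ)) 0 0 = (β' : SL(2, ℤ)) 0 0 := by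
    rw [gamma0_mul_apply_zero_zero', e00, e01, hL'00, hL'10]; linear_combination -hs
  have f01 : ((L * β * L' : Gamma0 N) : SL(2, ℤ)) 0 1 = b := by
    rw [gamma0_mul_apply_zero_one, e00, e01, hL'01, hL'11]; ring
  have f11 : ((L * β * L' : Gamma0 N) : SL(2, ℤ)) 1 1 = (β' : SL(2, ℤ)) 1 1 := by
    rw [gamma0_mul_apply_one_one', hL'01, mul_zero, zero_add, e11, hL'11]; linear_combination -ht
  -- equality with `β'` (the lower-left entries agree by the determinant, `b ≠ 0`)
  have hdet'' := Matrix.SpecialLinearGroup.det_coe ((L * β * L' : Gamma0 N) : SL(2, ℤ))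
  rw [Matrix.det_fin_two, f00, f01, f11] at hdet''
  have f10 : ((L * β * L' : Gamma0 N) : SL(2, ℤ)) 1 0 = (β' : SL(2, ℤ)) 1 0 := by
    have : b * (((L * β * L' : Gamma0 N) : SL(2, ℤ)) 1 0 - (β' : SL(2, ℤ)) 1 0) = 0 := by linear_combination hdet' - hdet''
    rcases mul_eq_zero.mp this with h | h
    · exact absurd h hb0
    · linear_combination h
  have hprod : L * β * L' = β' := ThetaLayerLambdaCongruenceAtTwo.gamma0_ext f00 (by rw [f01, hb']) f10 f11
  rw [← hprod, hadd, hadd, hL, hL', zero_add, add_zero]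

/-- **The companion.** For `γ = (a, b; c, d) ∈ Γ₀(N)` the element `γ' = (−d, b; c, −a)` lies in `Γ₀(N)`, `γγ' = −I`, so `χ γ' = χ γ`.
[folklore] -/
theorem exists_companion (hadd : ∀ γ δ : Gamma0 N, χ (γ * δ) = χ γ + χ δ)
    (hsmall : ∀ γ : Gamma0 N, ((γ : SL(2, ℤ)) 0 0 + (γ : SL(2, ℤ)) 1 1).natAbs ≤ 2 → χ γ = 0) (γ : Gamma0 N) :
    ∃ γ' : Gamma0 N, (γ' : SL(2, ℤ)) 0 0 = -(γ : SL(2, ℤ)) 1 1 ∧ (γ' : SL(2, ℤ)) 0 1 = (γ : SL(2, ℤ)) 0 1 ∧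
      (γ' : SL(2, ℤ)) 1 1 = -(γ : SL(2, ℤ)) 0 0 ∧ χ γ' = χ γ := by
  have hdet := Matrix.SpecialLinearGroup.det_coe (γ : SL(2, ℤ))
  rw [Matrix.det_fin_two] at hdet
  have hcN : (N : ℤ) ∣ (γ : SL(2, ℤ)) 1 0 := by
    have hmem := γ.2
    rw [Gamma0_mem] at hmem
    exact (ZMod.intCast_zmod_eq_zero_iff_dvd _ N).mp hmem
  obtain ⟨γ', h00, h01, h10, h11⟩ := ThetaLayerLambdaCongruenceAtTwo.exists_gamma0_entries (N := N)
    (-(γ : SL(2, ℤ)) 1 1) ((γ : SL(2, ℤ)) 0 1) ((γ : SL(2, ℤ)) 1 0) (-(γ : SL(2, ℤ)) 0 0) (by linear_combination hdet) hcN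
  refine ⟨γ', h00, h01, h11, ?_⟩
  have htr : (((γ * γ' : Gamma0 N) : SL(2, ℤ)) 0 0 + ((γ * γ' : Gamma0 N) : SL(2, ℤ)) 1 1).natAbs ≤ 2 := by
    rw [gamma0_mul_apply_zero_zero', gamma0_mul_apply_one_one', h00, h10, h01, h11]
    have e : (γ : SL(2, ℤ)) 0 0 * -(γ : SL(2, ℤ)) 1 1 + (γ : SL(2, ℤ)) 0 1 * (γ : SL(2, ℤ)) 1 0 +
        ((γ : SL(2, ℤ)) 1 0 * (γ : SL(2, ℤ)) 0 1 + (γ : SL(2, ℤ)) 1 1 * -(γ : SL(2, ℤ)) 0 0) = -2 := by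
      linear_combination (-2 : ℤ) * hdet
    rw [e]; decide
  have h0 := hsmall _ htr
  rw [hadd] at h0
  have e : χ γ' = -χ γ := by linear_combination h0
  rw [e, ZMod.neg_eq_self_mod_two]

/-! ## §2. The `β₃` step -/

/-- **The `β₃` step at an odd level.** For `g ∈ Γ₀(N)` (`N` odd) and `k ≥ 1` with `d(g) ∣ c(g) + 4^k` there is a `b = −1` element `β₃`
with `(gβ₃)₁₁ = 4^k` exactly. [folklore] -/
theorem exists_b1_mul_apply_one_one_eq_four_pow (hN : Odd N) (g : Gamma0 N) (k : ℕ)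
    (hdvd : (g : SL(2, ℤ)) 1 1 ∣ (g : SL(2, ℤ)) 1 0 + 4 ^ k) :
    ∃ β₃ : Gamma0 N, (β₃ : SL(2, ℤ)) 0 1 = -1 ∧ ((g * β₃ : Gamma0 N) : SL(2, ℤ)) 1 1 = 4 ^ k := by
  obtain ⟨δ₃, hδ⟩ := hdvd
  have hcN : (N : ℤ) ∣ (g : SL(2, ℤ)) 1 0 := by
    have hmem := g.2
    rw [Gamma0_mem] at hmem
    exact (ZMod.intCast_zmod_eq_zero_iff_dvd _ N).mp hmem
  obtain ⟨c', hc'⟩ := hcN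
  have h2N : Nat.Coprime 2 N := Nat.coprime_two_left.mpr hN
  have hcop4 : IsCoprime ((4 : ℤ) ^ k) N := by
    apply IsCoprime.pow_left
    rw [show (4 : ℤ) = ((4 : ℕ) : ℤ) by norm_num, Nat.isCoprime_iff_coprime]
    simpa using h2N.pow_left 2
  have hdδ : (g : SL(2, ℤ)) 1 1 * δ₃ = 4 ^ k + c' * N := by linear_combination -hδ + hc'
  have hcopδ : IsCoprime δ₃ (N : ℤ) := by
    have e1 : IsCoprime ((g : SL(2, ℤ)) 1 1 * δ₃) N := by rw [hdδ]; exact hcop4.add_mul_right_left c'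
    exact e1.of_mul_left_right
  obtain ⟨α₃, κ₃, h3⟩ := hcopδ
  obtain ⟨β₃, -, h301, -, h311⟩ := ThetaLayerLambdaCongruenceAtTwo.exists_gamma0_entries (N := N)
    α₃ (-1) (N * κ₃) δ₃ (by linear_combination h3) (dvd_mul_right _ _)
  refine ⟨β₃, h301, ?_⟩
  rw [gamma0_mul_apply_one_one', h301, h311]; linear_combination -hδ

end AnyLevel

/-! ## §3. The auxiliary prime for the row `B₃` -/

/-- `legendreSym n 3 = −1` for a prime `n ≡ 1 (mod 4)`, `n ≡ 2 (mod 3)`; hence `3^{(n−1)/2} = −1` in `ZMod n`. [folklore] -/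
theorem three_pow_half_eq_neg_one (n : ℕ) (hn : n.Prime) (hn4 : n % 4 = 1) (hn3 : n % 3 = 2) :
    (3 : ZMod n) ^ (n / 2) = -1 := by
  haveI : Fact n.Prime := ⟨hn⟩
  haveI : Fact (Nat.Prime 3) := ⟨Nat.prime_three⟩
  have hn2 : n ≠ 2 := by intro h; rw [h] at hn4; norm_num at hn4
  have h1 : legendreSym 3 (n : ℤ) = legendreSym n 3 :=
    legendreSym.quadratic_reciprocity_one_mod_four hn4 (by norm_num)
  have h2 : legendreSym 3 (n : ℤ) = -1 := by
    rw [legendreSym.mod]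
    have : ((n : ℤ) % ((3 : ℕ) : ℤ)) = 2 := by push_cast; omega
    rw [this]; norm_num
  have h3 : legendreSym n 3 = -1 := by rw [← h1, h2]
  have h := legendreSym.eq_pow n 3
  rw [h3] at h
  push_cast at h
  exact h.symm

/-- **The auxiliary prime for `B₃`.** For odd `N` prime to `3` and `a` prime to `N`, and any `w`: a prime `n > 3N` with `n ≡ a (mod N)`,
`n ≡ 2 (mod 3)`, `n ≡ 1 + 2^{w+2} (mod 2^{w+3})` (so `n ≡ 1 (mod 4)` and `2^w ∣ (n−1)/2`) and `3^{(n−1)/2} ≡ −1 (mod n)`. [folklore] -/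
theorem exists_aux_prime_three {N : ℕ} (hN : Odd N) (h3N : ¬ 3 ∣ N) (a : ℕ) (ha : Nat.Coprime a N) (w : ℕ) :
    ∃ n : ℕ, n.Prime ∧ 3 * N < n ∧ n ≡ a [MOD N] ∧ n % 3 = 2 ∧ 2 ^ w ∣ n / 2 ∧ n % 4 = 1 ∧
      (3 : ZMod n) ^ (n / 2) = -1 := by
  have hN0 : N ≠ 0 := by rintro rfl; exact absurd hN (by decide)
  -- moduli `N`, `3`, `2^{w+3}` pairwise coprime
  have c3 : Nat.Coprime N 3 := (Nat.coprime_comm.mp ((Nat.Prime.coprime_iff_not_dvd Nat.prime_three).mpr h3N))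
  have c2 : Nat.Coprime (N * 3) (2 ^ (w + 3)) := by
    apply Nat.Coprime.pow_right
    apply Nat.Coprime.mul_left
    · exact Nat.coprime_two_right.mpr hN
    · norm_num
  obtain ⟨r₁, hr₁N, hr₁3⟩ := Nat.chineseRemainder c3 a 2
  obtain ⟨r₂, hr₂, hr₂2⟩ := Nat.chineseRemainder c2 r₁ (1 + 2 ^ (w + 2))
  have hrN : r₂ ≡ a [MOD N] := (hr₂.of_mul_right 3).trans hr₁N
  have hr3 : r₂ ≡ 2 [MOD 3] := (hr₂.of_mul_left N).trans hr₁3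
  have hlt : 1 + 2 ^ (w + 2) < 2 ^ (w + 3) := by
    have h1 : 1 < 2 ^ (w + 2) := Nat.one_lt_two_pow (by omega)
    have h2 : 2 ^ (w + 3) = 2 ^ (w + 2) + 2 ^ (w + 2) := by ring
    rw [h2]; omega
  have hcop : Nat.Coprime r₂ (N * 3 * 2 ^ (w + 3)) := by
    apply Nat.Coprime.mul_right
    · apply Nat.Coprime.mul_right
      · rw [Nat.Coprime, hrN.gcd_eq]; exact ha
      · rw [Nat.Coprime, hr3.gcd_eq]; norm_num
    · apply Nat.Coprime.pow_right
      have hodd : r₂ % 2 = 1 := by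
        obtain ⟨j, hj⟩ : ∃ j, r₂ = 1 + 2 ^ (w + 2) + 2 ^ (w + 3) * j := by
          unfold Nat.ModEq at hr₂2
          rw [Nat.mod_eq_of_lt hlt] at hr₂2
          exact ⟨r₂ / 2 ^ (w + 3), by rw [← hr₂2]; exact (Nat.mod_add_div r₂ _).symm⟩
        have : r₂ = 1 + 2 * (2 ^ (w + 1) * (1 + 2 * j)) := by rw [hj]; ring
        omega
      exact Nat.coprime_two_right.mpr (Nat.odd_iff.mpr hodd)
  obtain ⟨n, hngt, hnprime, hnmod⟩ := Nat.forall_exists_prime_gt_and_modEq (3 * N) (q := N * 3 * 2 ^ (w + 3)) (a := r₂)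
    (by positivity) hcop
  have hnN : n ≡ a [MOD N] := ((hnmod.of_mul_right _).of_mul_right 3).trans hrN
  have hn3 : n % 3 = 2 := by
    have := ((hnmod.of_mul_right _).of_mul_left N).trans hr3
    unfold Nat.ModEq at this; simpa using this
  have hn2 : n ≡ 1 + 2 ^ (w + 2) [MOD 2 ^ (w + 3)] := (hnmod.of_mul_left _).trans hr₂2
  -- `n = 1 + 2^{w+2} + 2^{w+3} j = 1 + 4·(2^w (1 + 2j))`
  obtain ⟨j, hj⟩ : ∃ j, n = 1 + 2 ^ (w + 2) + 2 ^ (w + 3) * j := by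
    unfold Nat.ModEq at hn2
    rw [Nat.mod_eq_of_lt hlt] at hn2
    exact ⟨n / 2 ^ (w + 3), by rw [← hn2]; exact (Nat.mod_add_div n _).symm⟩
  have hn' : n = 1 + 4 * (2 ^ w * (1 + 2 * j)) := by rw [hj]; ring
  have hn4 : n % 4 = 1 := by omega
  have hh : n / 2 = 2 ^ w * (2 * (1 + 2 * j)) := by
    have : n / 2 = 2 * (2 ^ w * (1 + 2 * j)) := by omega
    rw [this]; ring
  refine ⟨n, hnprime, hngt, hnN, hn3, ⟨2 * (1 + 2 * j), hh⟩, hn4, three_pow_half_eq_neg_one n hnprime hn4 hn3⟩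

end Summit.BirchSwinnertonDyer.BirchSwinnertonDyer.Theorems.SignedMuAtTwo
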